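import Literature.MathematicalPhysics.QuantumFieldTheory.Balaban1983to89.B7SectCDGaugeAveragesRec
import Literature.MathematicalPhysics.QuantumFieldTheory.Balaban1983to89.BlockAveragingZdCovariance
import Literature.MathematicalPhysics.QuantumFieldTheory.Balaban1983to89.B7Eq92Concrete

/-!
# `Balaban1983to89.B7Eq92ConcreteRec` — [Balaban1985Averaging] Sect. C–D (59), (89)–(97) pp. 27–32 FOR THE RECORD's AVERAGING STRUCTURE ([Balaban1987RG1] (0.3)–(0.4)):
# the covariance of `Ṽ₁` under moving frames (59)∕(93), (89) solved for `Ṽ₁`, (95), and THE FUNDAMENTAL EQUALITY (92)∕(97) `Ũ₁ᵏ = (U̿₁ᵏ)^{v_k}` for the record twins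
# `tildZ ∕ dbavgCovZ ∕ tildIterZ ∕ dbavgCovIterZ ∕ vcovZ` — exact identities, proofs re-run from the engine's `B7Eq92Concrete`

statement-level skeleton of published theorems with citation tags; proofs where landed; nothing here is a claim about the Yang–Mills mass gap

CITATION HEADER (lean-in-tree rule).  Cell `pub-ymgap`, seat `pub-ymgap-dag-n05-e` g35 (N05-REC LEAD PEN); item R1 ([3] layer) of the road — the Sect. C–D IDENTITIES the cell's R4 (`B8Eq131Derivation`
twin, n05-d) and R5 (Sect. E, n05-c) wait for.  `--kind proof --supports stmt-QuantumFields-20541` (K0⁷; count-neutral; no definition).  Sources READ: [3] pp. 27–32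
(`paper:balaban1985-cmp98-averaging`) through the engine module `B7Eq92Concrete`, whose §2–§3 proofs are re-run token for token over the record objects (TOKEN RULE: `bavg ↦ bavgZ`,
`avgIter ↦ avgIterZ`, the Sect. C–D objects ↦ their `…Z` twins of `B7SectCDGaugeAveragesRec`; covariance from `BlockAveragingZdCovariance.bavgZ_gaugeAct_units ∕ avgIterZ_gaugeAct_units`).
These identities are EXACT for the record structure (they use only the covariance of the average — NODE 00's `ShearedAveragingFlat` proves the same abstractly); the group algebra §1 of the
engine (`Rc`, `mgauge`, `tHol`, …) and the abstract skeleton `B7Transfer` are REUSED BY NAME.  The flat-background reductions to `B7Prop3Flat∕B7Prop4Flat∕B7Prop6Flat` are NOT twinned here.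
WHAT IS PROVED (sorry-free): §2 `tildZ_apply`, `dbavgCovZ_apply`, ★`tildZ_mgauge` ((59)∕(93)), `tildZ_eq_frame_dbavgCovZ` ((89) solved), `tildZ_mgauge_inv_wframeZ` ((95)), `rescale_tildZ_eq_mgauge`,
the `B7Transfer` dictionary (`frame_eq_mgauge` reused) `dbar_eq_dbavgCovZ`, ★`hcov_concreteZ`; §3 `dbavgCovIterZ_succ_apply`, `vcovZ_succ_apply`, `tildIterZ_mul`, `tildIterZ_succ`, ★★★`tildIterZ_eq_mgauge`
((92)∕(97): `Ũ₁ᵏ = (U̿₁ᵏ)^{v_k}` for the record), `avgIterZ_mul_eq_gaugeAct`, `val_avgIterZ_mul_eq`, `tildIterZ_mgauge`.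
HONEST SCOPE.  Exact algebraic identities for OUR typed record objects; no estimate; `HThm4Rec` UNDISCHARGED; N05 ∕ N07 NOT discharged; counts unmoved (typed 28∕28 · discharged 7∕28);
one finite 𝕋⁴ programme at fixed ε — nothing continuum ∕ ℝ⁴ ∕ OS ∕ mass gap ∕ Clay.  No `def`, no `instance`, no `notation`, no `sorry`.
-/

set_option autoImplicit false

noncomputable section

open scoped BigOperators
open NormedSpace Finset

namespace Literature.MathematicalPhysics.QuantumFieldTheory.Balaban1983to89.B7Eq92ConcreteRec

open B7Prop1Explicit hiding Site
open B7Prop1Explicit renaming Site → SiteZ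
open B7Prop2Explicit (rescale rescale_apply)
open MatrixLog B7AvgGaugeCovariance
open B7Eq92Concrete (Rc Rc_apply Rc_mul Rc_inv_apply mgauge mgauge_apply mgauge_mul tHol tHol_append_true tHol_append_false tHol_mgauge mlog_Rc expUnit_conj
  frame_eq_mgauge)
open BlockAveragingZd (bavgZ avgIterZ avgIterZ_zero avgIterZ_succ)
open BlockAveragingZdCovariance (bavgZ_gaugeAct_units avgIterZ_gaugeAct_units)
open B7SectCDGaugeAveragesRec (FcovZ wframeZ tildZ dbavgCovZ tildIterZ dbavgCovIterZ vcovZ)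

variable {d : ℕ}

/-! ## §2 The one-step objects at an arbitrary background: (59)∕(93), (89), (95) -/

section OneStep

variable {𝔸 : Type*} [NormedRing 𝔸] [NormedAlgebra ℂ 𝔸] [CompleteSpace 𝔸]

/-- `tildZ_apply`: (65) unfolded. [cite: Balaban1985Averaging, (65) p.29] -/
@[simp] theorem tildZ_apply (L : ℕ) (V₀ V₁ : SiteZ d → Fin d → 𝔸ˣ) (q : SiteZ d) (κ : Fin d) :
    tildZ L V₀ V₁ q κ = bavgZ L (V₁ * V₀) q κ * (bavgZ L V₀ q κ)⁻¹ := rfl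

/-- `dbavgCovZ_apply`: (89) unfolded. [cite: Balaban1985Averaging, (89) p.31] -/
theorem dbavgCovZ_apply (L : ℕ) (V₀ V₁ : SiteZ d → Fin d → 𝔸ˣ) (q : SiteZ d) (κ : Fin d) :
    dbavgCovZ L V₀ V₁ q κ
      = (wframeZ L V₀ V₁ q)⁻¹ * tildZ L V₀ V₁ q κ * Rc (bavgZ L V₀ q κ) (wframeZ L V₀ V₁ (q + (L : ℤ) • e κ)) := rfl

/-- **(59) p. 27 = (93) p. 32 — THE COVARIANCE OF THE ONE-STEP OPERATION `V₁ ↦ Ṽ₁` UNDER MOVING FRAMES, for EVERY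
invertible frame `v`** (no unitarity, no smallness: the frames `v_j` of (97)/(160) are complex; print p. 27: "V′ may have
values in the complexified group G^c", "for arbitrary invertible matrix X").  (59): "V̄_c(V̄₀)_c⁻¹ =
v(c₋)(\overline{V₁V₀})_c(V̄₀)_c⁻¹R̄_{0,c}v⁻¹(c₊), R̄_{0,c} = R((V̄₀)_c)" for `V = V′V₀`, `V′ = V₁^v`; (93): "for an arbitrary gauge
transformation v we write V = (V^{v⁻¹})^v = (V₁^{v⁻¹}V₀)^v and we have (Ṽ₁)_c = (\overline{V₁V₀})_cV̄_{0,−c} =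
v(c₋)(\widetilde{V₁^{v⁻¹}})_cR̄_{0,c}v⁻¹(c₊), c ⊂ Ω′^{(1)}" — both say `\widetilde{W^{v}}(c) = v(c₋)·W̃(c)·R̄_{0,c}v⁻¹(c₊)`
(`W = V₁`, resp. `W = V₁^{v⁻¹}`).  Proof = print's (p. 27 "V̄_c = (\overline{V′V₀})_c = (\overline{V₁^vV₀})_c =
v(c)(\overline{V₁V₀})_cv⁻¹(c₊)"): `(V₁^v)V₀ = (V₁V₀)^v` (`mgauge_mul`) and the covariance of the average (42), p. 27 first
sentence "(\overline{V^v})_c = v(c₋)V̄_cv⁻¹(c₊)" / p. 24 sentence after (43) (cell label (45)/(11)), valid for ARBITRARY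
invertible gauge functions (`B7Prop6Flat.bavgZ_gaugeAct_units`).  This is the hypothesis `hcov` of the abstract
`B7Transfer.step98`, DISCHARGED for B7's own average (`hcov_concrete`). [cite: Balaban1985Averaging, (59) p.27, (93) p.32, p.24, (11) p.19] -/
theorem tildZ_mgauge (L : ℕ) (V₀ V₁ : SiteZ d → Fin d → 𝔸ˣ) (v : SiteZ d → 𝔸ˣ) (q : SiteZ d) (κ : Fin d) :
    tildZ L V₀ (mgauge V₀ v V₁) q κ
      = v q * tildZ L V₀ V₁ q κ * (Rc (bavgZ L V₀ q κ) (v (q + (L : ℤ) • e κ)))⁻¹ := by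
  simp only [tildZ_apply, mgauge_mul, bavgZ_gaugeAct_units, Rc_apply]
  group

/-- **(89) solved for `Ṽ₁` = the fundamental equality (92) at `k = 1`** (p. 31: "For k = 1 the equality holds by the
definitions (89), (90), and the Eq. (63)"): `Ṽ₁(c) = w(c₋)·V̿₁(c)·R̄_{0,c}w(c₊)⁻¹`, `w = \overline{R_{0,·}V₁}` — group algebra,
no property of the average used (abstractly `B7Transfer.avg_eq_frame_dbar`). [cite: Balaban1985Averaging, (92) p.31, (89) p.31] -/
theorem tildZ_eq_frame_dbavgCovZ (L : ℕ) (V₀ V₁ : SiteZ d → Fin d → 𝔸ˣ) (q : SiteZ d) (κ : Fin d) :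
    tildZ L V₀ V₁ q κ
      = wframeZ L V₀ V₁ q * dbavgCovZ L V₀ V₁ q κ
          * (Rc (bavgZ L V₀ q κ) (wframeZ L V₀ V₁ (q + (L : ℤ) • e κ)))⁻¹ := by
  simp only [dbavgCovZ_apply, Rc_apply]
  group

/-- **(95) p. 32**: "(\widetilde{U₁^{v⁻¹}})_b = (\overline{R_{0,b₋}U₁})⁻¹Ũ_{1,b}R̄_{0,b}\overline{R_{0,b₊}U₁} = U̿₁" for
`v(x) = \overline{R_{0,x}U₁}` — the double-bar average IS the average `~` of the field moved by the INVERSE block frames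
(here `v⁻¹ = w⁻¹` extended to every site by the same formula (82), which is immaterial by (93)).
[cite: Balaban1985Averaging, (95) p.32, (94) p.32] -/
theorem tildZ_mgauge_inv_wframeZ (L : ℕ) (V₀ V₁ : SiteZ d → Fin d → 𝔸ˣ) :
    tildZ L V₀ (mgauge V₀ (fun x => (wframeZ L V₀ V₁ x)⁻¹) V₁) = dbavgCovZ L V₀ V₁ := by
  funext q κ
  rw [tildZ_mgauge, dbavgCovZ_apply, map_inv, inv_inv]

/-- (92) at `k = 1` read on the unit lattice `Ω^{(1)} ≅ ℤ^d` (`rescale`): `Ũ₁ = (U̿₁)^{w}` — the rescaled `Ṽ₁` IS the moving-frame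
transform (55), relative to the averaged background `V̄₀`, of the rescaled double-bar average by the block frames.
[cite: Balaban1985Averaging, (92) p.31, (55) p.27] -/
theorem rescale_tildZ_eq_mgauge (L : ℕ) (V₀ V₁ : SiteZ d → Fin d → 𝔸ˣ) :
    rescale L (tildZ L V₀ V₁)
      = mgauge (rescale L (bavgZ L V₀)) (fun z => wframeZ L V₀ V₁ ((L : ℤ) • z)) (rescale L (dbavgCovZ L V₀ V₁)) := by
  funext z κ
  rw [rescale_apply, tildZ_eq_frame_dbavgCovZ, mgauge_apply, rescale_apply, rescale_apply, smul_add]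

/-! ### Dictionary to the abstract transfer skeleton `B7Transfer` (arbitrary group, arbitrary recipe) -/

/-- The concrete double-bar average (89) is the abstract `B7Transfer.dbar` with `avg = Ṽ` (65), `σ_c = R̄_{0,c} = R((V̄₀)_c)`,
`w = \overline{R_{0,·}V₁}` (82), on the `L`-bonds `(q, κ) ≙ ⟨q, q + Le_κ⟩`. [cite: Balaban1985Averaging, (89) p.31] -/
theorem dbar_eq_dbavgCovZ (L : ℕ) (V₀ : SiteZ d → Fin d → 𝔸ˣ) (Y : SiteZ d × Fin d → 𝔸ˣ) :
    B7Transfer.dbar (fun c : SiteZ d × Fin d => c.1) (fun c => c.1 + (L : ℤ) • e c.2) (fun c => Rc (bavgZ L V₀ c.1 c.2))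
        (fun Y c => tildZ L V₀ (Function.curry Y) c.1 c.2) (fun Y y => wframeZ L V₀ (Function.curry Y) y) Y
      = Function.uncurry (dbavgCovZ L V₀ (Function.curry Y)) := by
  funext ⟨q, κ⟩
  simp only [B7Transfer.dbar_apply, Function.uncurry_apply_pair, dbavgCovZ_apply]

/-- **The covariance hypothesis `hcov` of `B7Transfer.step98` HOLDS for B7's own average (42)** — in the abstract file it is an
explicit binder ("for B7's own average (15)/(41) they are the printed (93)"); here it is a theorem (`tild_mgauge`).
[cite: Balaban1985Averaging, (93) p.32] -/
theorem hcov_concreteZ (L : ℕ) (V₀ : SiteZ d → Fin d → 𝔸ˣ) (v : SiteZ d → 𝔸ˣ) (Y : SiteZ d × Fin d → 𝔸ˣ) :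
    (fun c : SiteZ d × Fin d => tildZ L V₀ (Function.curry
        (B7Transfer.frame (fun b : SiteZ d × Fin d => b.1) (fun b => b.1 + e b.2) (fun b => Rc (V₀ b.1 b.2)) v Y)) c.1 c.2)
      = B7Transfer.frame (fun c : SiteZ d × Fin d => c.1) (fun c => c.1 + (L : ℤ) • e c.2)
          (fun c => Rc (bavgZ L V₀ c.1 c.2)) v (fun c => tildZ L V₀ (Function.curry Y) c.1 c.2) := by
  funext ⟨q, κ⟩
  rw [frame_eq_mgauge, Function.curry_uncurry, tildZ_mgauge, B7Transfer.frame_apply]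


end OneStep

/-! ## §3 The `k`-fold objects (69), (90)∕(91), (97) and THE FUNDAMENTAL EQUALITY (92)∕(97) -/

section Iterates

variable {𝔸 : Type*} [NormedRing 𝔸] [NormedAlgebra ℂ 𝔸] [CompleteSpace 𝔸]

/-- `tildIter_apply`: (69) unfolded. [cite: Balaban1985Averaging, (69) p.29] -/
@[simp] theorem tildIter_apply (L : ℕ) (U₀ U₁ : SiteZ d → Fin d → 𝔸ˣ) (j : ℕ) (z : SiteZ d) (κ : Fin d) :
    tildIterZ L U₀ U₁ j z κ = avgIterZ L (U₁ * U₀) j z κ * (avgIterZ L U₀ j z κ)⁻¹ := rfl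

/-- `dbavgCovIter_zero`: `U̿₁^0 = U₁`. [cite: Balaban1985Averaging, (90) p.31] -/
@[simp] theorem dbavgCovIter_zero (L : ℕ) (U₀ U₁ : SiteZ d → Fin d → 𝔸ˣ) : dbavgCovIterZ L U₀ U₁ 0 = U₁ := rfl

/-- `dbavgCovIterZ_succ_apply`: (91) bondwise. [cite: Balaban1985Averaging, (91) p.31] -/
theorem dbavgCovIterZ_succ_apply (L : ℕ) (U₀ U₁ : SiteZ d → Fin d → 𝔸ˣ) (j : ℕ) (z : SiteZ d) (κ : Fin d) :
    dbavgCovIterZ L U₀ U₁ (j + 1) z κ = dbavgCovZ L (avgIterZ L U₀ j) (dbavgCovIterZ L U₀ U₁ j) ((L : ℤ) • z) κ := rfl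

/-- `vcov_zero`: `v_0 = 1`. [cite: Balaban1985Averaging, (97) p.32] -/
@[simp] theorem vcov_zero (L : ℕ) (U₀ U₁ : SiteZ d → Fin d → 𝔸ˣ) (z : SiteZ d) : vcovZ L U₀ U₁ 0 z = 1 := rfl

/-- `vcovZ_succ_apply`: `v_{j+1}(z) = v_j(Lz)·\overline{R̄^j_{0,Lz}U̿₁^j}`. [cite: Balaban1985Averaging, (97) p.32] -/
theorem vcovZ_succ_apply (L : ℕ) (U₀ U₁ : SiteZ d → Fin d → 𝔸ˣ) (j : ℕ) (z : SiteZ d) :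
    vcovZ L U₀ U₁ (j + 1) z
      = vcovZ L U₀ U₁ j ((L : ℤ) • z) * wframeZ L (avgIterZ L U₀ j) (dbavgCovIterZ L U₀ U₁ j) ((L : ℤ) • z) := rfl

/-- `Ũ^0 = U₁`. [cite: Balaban1985Averaging, (69) p.29] -/
@[simp] theorem tildIter_zero' (L : ℕ) (U₀ U₁ : SiteZ d → Fin d → 𝔸ˣ) : tildIterZ L U₀ U₁ 0 = U₁ := by
  funext z κ
  simp

/-- (69) read as `Ũ^j·Ū₀^j = (\overline{U₁U₀})^j`. [cite: Balaban1985Averaging, (69) p.29] -/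
theorem tildIterZ_mul (L : ℕ) (U₀ U₁ : SiteZ d → Fin d → 𝔸ˣ) (j : ℕ) :
    tildIterZ L U₀ U₁ j * avgIterZ L U₀ j = avgIterZ L (U₁ * U₀) j := by
  funext z κ
  simp

/-- **(68)** p. 29: "Ũ′^{j+1}_c = (\overline{Ũ′^jŪ₀^j})_c(\overline{Ū₀^j})_c⁻¹" — the `(j+1)`-st object is the one-step
operation (65) at the background `Ū₀^j` applied to the `j`-th. [cite: Balaban1985Averaging, (68) p.29] -/
theorem tildIterZ_succ (L : ℕ) (U₀ U₁ : SiteZ d → Fin d → 𝔸ˣ) (j : ℕ) (z : SiteZ d) (κ : Fin d) :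
    tildIterZ L U₀ U₁ (j + 1) z κ = tildZ L (avgIterZ L U₀ j) (tildIterZ L U₀ U₁ j) ((L : ℤ) • z) κ := by
  rw [tildIter_apply, tildZ_apply, tildIterZ_mul, avgIterZ_succ, avgIterZ_succ, rescale_apply, rescale_apply]

/-- **THE FUNDAMENTAL EQUALITY (92)/(97) p. 31–32 AT AN ARBITRARY BACKGROUND, AS AN IDENTITY OF THE FORMAL OBJECTS**
(any `L`, any `j`, any unit-valued `U₀`, `U₁`; no smallness, no unitarity): "(Ũ₁^j)_b = v_j(b₋)(U̿₁^j)_bR̄^j_{0,b}v_j⁻¹(b₊) =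
(U̿₁^j)^{v_j}_b" — `Ũ^j` IS the moving-frame transform (55), relative to `Ū₀^j`, of the `j`-fold double-bar average (91)
by the accumulated frame (97).  Proof = print's induction (96)–(98): the step uses ONLY (68), the covariance (93)
(`tild_mgauge`) and (89) solved (`tildZ_eq_frame_dbavgCovZ`) — abstractly `B7Transfer.step98`.  The identification
(99)–(100) of `v_j` with the recursive block averages (85) is not restated here (`vcov` is (97) read directly).
[cite: Balaban1985Averaging, (92) p.31, (97) p.32, (96)–(98) p.32] -/
theorem tildIterZ_eq_mgauge (L : ℕ) (U₀ U₁ : SiteZ d → Fin d → 𝔸ˣ) :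
    ∀ j : ℕ, tildIterZ L U₀ U₁ j = mgauge (avgIterZ L U₀ j) (vcovZ L U₀ U₁ j) (dbavgCovIterZ L U₀ U₁ j)
  | 0 => by
    funext z κ
    simp
  | j + 1 => by
    funext z κ
    rw [tildIterZ_succ, tildIterZ_eq_mgauge L U₀ U₁ j, tildZ_mgauge, tildZ_eq_frame_dbavgCovZ, mgauge_apply,
      vcovZ_succ_apply, vcovZ_succ_apply, dbavgCovIterZ_succ_apply, avgIterZ_succ, rescale_apply, smul_add]
    simp only [map_mul, mul_inv_rev, mul_assoc, Rc_apply]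

/-- **(88)/(92) = (159) AT AN ARBITRARY BACKGROUND**: the `k`-fold average (43) of the product `U₁U₀` is the ORDINARY gauge
transform (8), by the accumulated frame `v_k` (97)/(160), of the product `U̿₁^k·Ū₀^k` of the `k`-fold double-bar average
(91) with the `k`-fold averaged background: `(\overline{U₁U₀})^k = (U̿₁^kŪ₀^k)^{v_k}`, i.e. bondwise
`Ū^k(b) = v_k(b₋)·U̿₁^k(b)·Ū₀^k(b)·v_k(b₊)⁻¹` (print (88): "Ū^k_b(Ū₀^k)_b⁻¹ = (\overline{U′U₀^k})_b(Ū₀^k)_b⁻¹ = … ", (159):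
"Ū^k_b(Ū^k_0)_b⁻¹ = … = v_k(b₋)(U̿′^k)_bR̄^k_{0,b}v_k⁻¹(b₊)").  At `U₀ = 1` this is `B7Prop6Flat.avgIter_eq_gaugeAct_vprod`.
[cite: Balaban1985Averaging, (88) p.31, (92) p.31, (159) p.42] -/
theorem avgIterZ_mul_eq_gaugeAct (L : ℕ) (U₀ U₁ : SiteZ d → Fin d → 𝔸ˣ) (k : ℕ) :
    avgIterZ L (U₁ * U₀) k = gaugeAct (vcovZ L U₀ U₁ k) (dbavgCovIterZ L U₀ U₁ k * avgIterZ L U₀ k) := by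
  rw [← tildIterZ_mul, tildIterZ_eq_mgauge, mgauge_mul]

/-- (159) at an arbitrary background, bondwise in `𝔸`: `Ū^k(c) = v_k(c₋)·U̿₁^k(c)·Ū₀^k(c)·v_k(c₊)⁻¹`, `c = ⟨z, z + e_κ⟩` a bond of
`Ω^{(k)} ≅ ℤ^d`, `Ū^k` the `k`-fold average of `U = U₁U₀`. [cite: Balaban1985Averaging, (159) p.42, (92) p.31] -/
theorem val_avgIterZ_mul_eq (L : ℕ) (U₀ U₁ : SiteZ d → Fin d → 𝔸ˣ) (k : ℕ) (z : SiteZ d) (κ : Fin d) :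
    ((avgIterZ L (U₁ * U₀) k z κ : 𝔸ˣ) : 𝔸)
      = (vcovZ L U₀ U₁ k z : 𝔸) * (dbavgCovIterZ L U₀ U₁ k z κ : 𝔸) * (avgIterZ L U₀ k z κ : 𝔸)
          * (((vcovZ L U₀ U₁ k (z + e κ))⁻¹ : 𝔸ˣ) : 𝔸) := by
  rw [avgIterZ_mul_eq_gaugeAct L U₀ U₁ k]
  simp only [gaugeAct, Pi.mul_apply, Units.val_mul, mul_assoc]

/-- **(70)/(71)** p. 29, gauge covariance of the `j`-fold objects under an invertible gauge function `u` of the ORIGINAL lattice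
(`u_j(z) = u(L^jz)`, `B7AvgGaugeCovariance.uLev`): "Ũ′^j_b = (Ũ₁^u)^j_b = u(b₋)(Ũ₁)^j_bR̄^j_{0,b}u⁻¹(b₊), b ⊂ Ω^{(j)}. (71)"
for `U′ = U₁^u` in the moving frame of `U₀` — from (11) for the product ((70): "Ū^j_b = (\overline{U₁^uU₀})^j_b =
u(b₋)(\overline{U₁U₀})^j_bu⁻¹(b₊), b ⊂ Ω^{(j)}", `B7Prop6Flat.avgIterZ_gaugeAct_units`).
[cite: Balaban1985Averaging, (70)–(71) p.29, (11) p.19] -/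
theorem tildIterZ_mgauge (L : ℕ) (U₀ U₁ : SiteZ d → Fin d → 𝔸ˣ) (u : SiteZ d → 𝔸ˣ) (j : ℕ) :
    tildIterZ L U₀ (mgauge U₀ u U₁) j = mgauge (avgIterZ L U₀ j) (uLev L u j) (tildIterZ L U₀ U₁ j) := by
  funext z κ
  rw [tildIter_apply, mgauge_mul, avgIterZ_gaugeAct_units, mgauge_apply, tildIter_apply]
  simp only [gaugeAct, Rc_apply]
  group


end Iterates

end Literature.MathematicalPhysics.QuantumFieldTheory.Balaban1983to89.B7Eq92ConcreteRec
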